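import Literature.NumberTheory.Transcendental.PkappaAnalyticGroupModel
import Literature.NumberTheory.Transcendental.PkappaThetaTangent
import Literature.NumberTheory.Transcendental.PkappaThetaWronskian
import Literature.NumberTheory.Transcendental.PkappaThetaNondeg
import HarnessLib

/-!
# The hard data of the theta model of `M_κ`: the analytic group model is unconditional

Topic: `Literature/NumberTheory/Transcendental`. A brick of the discharge of the named fact
`Literature.NumberTheory.Transcendental.philippon1986_std`. `PkappaAnalyticGroupModel.lean`
builds the theta model of `M_κ = 𝔾ₘ^β × P_κ` as an `AnalyticGroupModel` (`GaGmE.Std.thetaModel H`)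
and derives Philippon's zero estimate on `M_κ` (`GaGmE.Std.zero_estimate_theta`,
`GaGmE.Std.philippon_shape_of_classification`) from a datum `H : GaGmE.Std.HardData L κM` of the
four hard geometric inputs on the embedding. Here that datum is CONSTRUCTED from the tree
(`GaGmE.Std.hardData`), so the model and the zero estimate become unconditional:

* `surj` — the image theorem `GaGmE.Std.theta_surj'` (`PkappaThetaTangent.lean`);
* `locRel` — the Jacobian criterion `GaGmE.Std.theta_locRel` (`PkappaThetaTangent.lean`);
* `nondeg` — the non-degenerate point `GaGmE.Std.exists_nondeg_point` (`PkappaThetaNondeg.lean`);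
* `wronsk`, `isHomogeneous_wronsk`, `F_wronsk` — the Wronskian forms `GaGmE.Std.wronsk` and
  `GaGmE.Std.F_wronsk` (`PkappaThetaWronskian.lean`),

each transported along the indexing bijection `idxEquiv : Fin (N + 1) ≃ Option β × ThetaIdx γ δ`
(`rename`, `eval_rename`, `pderiv_rename`, and `LinearMap.funLeft` for the gradients). Corollaries:
`GaGmE.Std.thetaModel₀` (the model), `GaGmE.Std.zero_estimate_theta₀` (Philippon's zero estimate
on `M_κ` with an abstract obstruction subgroup) and `GaGmE.Std.philippon_of_classification` (the
named fact for `(L, κ, β, γ, δ)` from the classification hypothesis alone). Everything is PROVED;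
the only definition is the datum.

## References

* P. Philippon, *Lemmes de zéros dans les groupes algébriques commutatifs*, Bull. Soc. Math.
  France 114 (1986), 355–383, Thm. 2.1. [Philippon1986]
* Yu. V. Nesterenko, P. Philippon (eds.), *Introduction to Algebraic Independence Theory*,
  LNM 1752, Springer 2001, Ch. 11 (D. Roy), §2.1–§2.3, Lemma 3.1, Thm. 4.1. [NesterenkoPhilippon2001]
-/

noncomputable section

open Complex MvPolynomial Set Module
open scoped PeriodPair Pointwise

namespace Literature.NumberTheory.Transcendental

namespace GaGmE

namespace Std

variable {β γ δ : Type} [Fintype β] [Fintype γ] [Fintype δ] [DecidableEq γ]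
variable (L : PeriodPair) (κM : δ → γ → Kbar)

/-! ### Transport along the indexing bijection -/

/-- `Θf J w = Θ_{e J}(w)`. [folklore] -/
theorem Θf_eq (J : Fin (nIdx β γ δ + 1)) (w : β ⊕ (γ ⊕ δ) → ℂ) :
    Θf L κM J w = theta L κM (idxEquiv β γ δ J) w := rfl

/-- `Θf (e⁻¹ K) w = Θ_K(w)`. [folklore] -/
theorem Θf_symm (K : Option β × ThetaIdx γ δ) (w : β ⊕ (γ ⊕ δ) → ℂ) :
    Θf L κM ((idxEquiv β γ δ).symm K) w = theta L κM K w := by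
  rw [Θf_eq, Equiv.apply_symm_apply]

omit [Fintype β] [Fintype γ] [Fintype δ] [DecidableEq γ] in
/-- Evaluation of a renamed polynomial at `x` is evaluation of the polynomial at `x ∘ e⁻¹`.
[folklore] -/
theorem eval_rename_symm {ι κ : Type*} (e : ι ≃ κ) (x : ι → ℂ) (P : MvPolynomial κ ℂ) :
    eval x (rename e.symm P) = eval (fun K => x (e.symm K)) P := by
  rw [eval_rename]
  rfl

/-! ### The four hard inputs, transported -/

/-- **Surjectivity** (from `theta_surj'`). [folklore] -/
theorem hard_surj (x : Fin (nIdx β γ δ + 1) → ℂ)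
    (hrel : ∀ (P : MvPolynomial (Fin (nIdx β γ δ + 1)) ℂ) (d : ℕ), P.IsHomogeneous d →
      (∀ w, eval (fun J => Θf L κM J w) P = 0) → eval x P = 0)
    (hb : ∃ u ∈ (Finset.univ : Finset (γ → Fin 3)).image
        (fun Mc => ∏ a : Option β, (X ((idxEquiv β γ δ).symm (a, (Mc, none))) : MvPolynomial _ ℂ)),
      eval x u ≠ 0) :
    ∃ (c : ℂ) (w : β ⊕ (γ ⊕ δ) → ℂ), x = c • fun J => Θf L κM J w := by
  classical
  set e := idxEquiv β γ δ with he
  set x' : Option β × ThetaIdx γ δ → ℂ := fun K => x (e.symm K) with hx'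
  have hrel' : ∀ (P : MvPolynomial (Option β × ThetaIdx γ δ) ℂ) (d : ℕ), P.IsHomogeneous d →
      (∀ w, thetaEval L κM P w = 0) → eval x' P = 0 := by
    intro P d hd h0
    have h := hrel (rename e.symm P) d hd.rename_isHomogeneous fun w => by
      rw [eval_Θf_rename]; exact h0 w
    rwa [eval_rename_symm] at h
  have hb' : ∃ M : Option β → (γ → Fin 3), eval x' (bdryForm (δ := δ) M) ≠ 0 := by
    obtain ⟨u, hu, hux⟩ := hb
    obtain ⟨Mc, -, rfl⟩ := Finset.mem_image.mp hu
    refine ⟨fun _ => Mc, ?_⟩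
    rw [eval_bdryForm]
    simpa [map_prod, eval_X, hx'] using hux
  obtain ⟨c, w, hw⟩ := theta_surj' L κM x' hrel' hb'
  refine ⟨c, w, funext fun J => ?_⟩
  have h := congr_fun hw (e J)
  simp only [hx', Equiv.symm_apply_apply, Pi.smul_apply, thetaVec_apply, smul_eq_mul] at h
  simpa [Θf_eq] using h

/-- **The Jacobian criterion** (from `theta_locRel`). [folklore] -/
theorem hard_locRel (w : β ⊕ (γ ⊕ δ) → ℂ) :
    ∃ S : Finset (MvPolynomial (Fin (nIdx β γ δ + 1)) ℂ),
      (∀ P ∈ S, ∃ d, P.IsHomogeneous d) ∧ (∀ P ∈ S, ∀ w', eval (fun J => Θf L κM J w') P = 0) ∧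
      S.card + Fintype.card (β ⊕ (γ ⊕ δ)) = nIdx β γ δ ∧
      LinearIndependent ℂ fun P : S => fun J => eval (fun J' => Θf L κM J' w) (pderiv J P.1) := by
  classical
  set e := idxEquiv β γ δ with he
  obtain ⟨S, hhom, hvan, hcard, hli⟩ := theta_locRel L κM w
  set r : MvPolynomial (Option β × ThetaIdx γ δ) ℂ → MvPolynomial (Fin (nIdx β γ δ + 1)) ℂ :=
    fun P => rename e.symm P with hr
  have hrinj : Function.Injective r := fun P Q h => rename_injective (R := ℂ) _ e.symm.injective h
  refine ⟨S.image r, ?_, ?_, ?_, ?_⟩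
  · intro P' hP'
    obtain ⟨P, hP, rfl⟩ := Finset.mem_image.mp hP'
    obtain ⟨d, hd⟩ := hhom P hP
    exact ⟨d, hd.rename_isHomogeneous⟩
  · intro P' hP' w'
    obtain ⟨P, hP, rfl⟩ := Finset.mem_image.mp hP'
    simp only [hr]
    rw [eval_Θf_rename]
    exact hvan P hP w'
  · rw [Finset.card_image_of_injective _ hrinj]
    have := nIdx_succ β γ δ
    omega
  · -- the gradients in the new indexing are the old gradients composed with `e`
    let F : MvPolynomial (Option β × ThetaIdx γ δ) ℂ → (Option β × ThetaIdx γ δ → ℂ) :=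
      fun P K => thetaEval L κM (pderiv K P) w
    let Φ : (Option β × ThetaIdx γ δ → ℂ) →ₗ[ℂ] (Fin (nIdx β γ δ + 1) → ℂ) := LinearMap.funLeft ℂ ℂ e
    have hΦ : LinearMap.ker Φ = ⊥ :=
      LinearMap.ker_eq_bot.mpr (LinearMap.funLeft_injective_of_surjective ℂ ℂ e e.surjective)
    have hli' : LinearIndependent ℂ (Φ ∘ fun P : S => F P.1) := hli.map' Φ hΦ
    -- reindex by the bijection `S.image r ≃ S`
    let g : {P' // P' ∈ S.image r} → {P // P ∈ S} := fun P' =>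
      ⟨(Finset.mem_image.mp P'.2).choose, (Finset.mem_image.mp P'.2).choose_spec.1⟩
    have hg : ∀ P' : {P' // P' ∈ S.image r}, r (g P').1 = P'.1 := fun P' =>
      (Finset.mem_image.mp P'.2).choose_spec.2
    have hginj : Function.Injective g := by
      intro P Q hPQ
      apply Subtype.ext
      rw [← hg P, ← hg Q, hPQ]
    have hli'' := hli'.comp g hginj
    convert hli'' using 1
    funext P'
    funext J
    simp only [Function.comp_apply, Φ, LinearMap.funLeft_apply, F]
    rw [← hg P']
    simp only [hr]
    have hpd : pderiv J (rename e.symm (g P').1) = rename e.symm (pderiv (e J) (g P').1) := by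
      have h := pderiv_rename e.symm.injective (e J) ((g P').1 : MvPolynomial (Option β × ThetaIdx γ δ) ℂ)
      rwa [Equiv.symm_apply_apply] at h
    rw [hpd, eval_Θf_rename]

/-- **One non-degenerate point** (from `exists_nondeg_point`). [folklore] -/
theorem hard_nondeg :
    ∃ (w₀ : β ⊕ (γ ⊕ δ) → ℂ) (J₀ : Fin (nIdx β γ δ + 1))
      (Js : Fin (Fintype.card (β ⊕ (γ ⊕ δ))) → Fin (nIdx β γ δ + 1)), Θf L κM J₀ w₀ ≠ 0 ∧
    ∀ x : β ⊕ (γ ⊕ δ) → ℂ,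
      (∀ i, deriv (fun t : ℂ => Θf L κM (Js i) (w₀ + t • x) / Θf L κM J₀ (w₀ + t • x)) 0 = 0) → x = 0 := by
  obtain ⟨w₀, J₀, Js, hJ₀, hinj⟩ := exists_nondeg_point (β := β) L κM
  refine ⟨w₀, (idxEquiv β γ δ).symm J₀,
    fun i => (idxEquiv β γ δ).symm (Js ((Fintype.equivFin (β ⊕ (γ ⊕ δ))).symm i)), by rwa [Θf_symm],
    fun x hx => hinj x fun k => ?_⟩
  have h := hx (Fintype.equivFin (β ⊕ (γ ⊕ δ)) k)
  simp only [Θf_symm, Equiv.symm_apply_apply] at h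
  exact h

variable [DecidableEq β] [DecidableEq δ]

/-- **The Wronskian forms**, transported. [folklore] -/
def hardWronsk (x : β ⊕ (γ ⊕ δ) → ℂ) (I J : Fin (nIdx β γ δ + 1)) : MvPolynomial (Fin (nIdx β γ δ + 1)) ℂ :=
  rename (idxEquiv β γ δ).symm (wronsk L κM x (idxEquiv β γ δ I) (idxEquiv β γ δ J))

/-- The transported Wronskian forms are quadratic. [folklore] -/
theorem hardWronsk_isHomogeneous (x : β ⊕ (γ ⊕ δ) → ℂ) (I J : Fin (nIdx β γ δ + 1)) :
    (hardWronsk L κM x I J).IsHomogeneous 2 :=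
  (wronsk_isHomogeneous L κM x _ _).rename_isHomogeneous

/-- **`Θ_J ∂_xΘ_I - Θ_I ∂_xΘ_J = Q_{x,I,J}(Θ)`** in the new indexing (from `F_wronsk`). [folklore] -/
theorem hard_F_wronsk (x : β ⊕ (γ ⊕ δ) → ℂ) (I J : Fin (nIdx β γ δ + 1)) (w : β ⊕ (γ ⊕ δ) → ℂ) :
    Θf L κM J w * deriv (fun t : ℂ => Θf L κM I (w + t • x)) 0 -
        Θf L κM I w * deriv (fun t : ℂ => Θf L κM J (w + t • x)) 0 =
      eval (fun K => Θf L κM K w) (hardWronsk L κM x I J) := by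
  rw [hardWronsk, eval_Θf_rename]
  exact F_wronsk L κM x (idxEquiv β γ δ I) (idxEquiv β γ δ J) w

/-! ### The datum and the unconditional model -/

/-- **The hard data of the theta model of `M_κ`, constructed.** [cite: NesterenkoPhilippon2001, Ch. 11 §2.1–§2.3, Lemma 3.1] -/
def hardData : HardData (β := β) L κM where
  surj := hard_surj L κM
  locRel := hard_locRel L κM
  nondeg := hard_nondeg L κM
  wronsk := hardWronsk L κM
  isHomogeneous_wronsk := hardWronsk_isHomogeneous L κM
  F_wronsk := hard_F_wronsk L κM

/-- **The theta model of `M_κ` as an analytic group model, unconditionally.**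
[cite: NesterenkoPhilippon2001, Ch. 11 §2.1 (84)] -/
def thetaModel₀ : AnalyticGroupModel (β ⊕ (γ ⊕ δ) → ℂ) (nIdx β γ δ) := thetaModel L κM (hardData L κM)

/-- **Philippon's zero estimate on `M_κ`** (Roy's Thm. 4.1 for the theta model), with the
obstruction an abstract closed irreducible subgroup `H₀ ⊆ Lie M_κ,ℂ` of the theta-Zariski topology,
unconditionally. [cite: Philippon1986, Thm. 2.1] [cite: NesterenkoPhilippon2001, Ch. 11 Thm. 4.1] -/
theorem zero_estimate_theta₀ (𝔟 : Submodule ℂ (β ⊕ (γ ⊕ δ) → ℂ)) (v : β ⊕ (γ ⊕ δ) → ℂ)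
    {P : MvPolynomial (Option β × ThetaIdx γ δ) ℂ} {D : ℕ} (S T : ℕ) (hP : P.IsHomogeneous D)
    (hP0 : ∃ w, thetaEval L κM P w ≠ 0)
    (hvan : ∀ s : ℕ, s ≤ Fintype.card (β ⊕ (γ ⊕ δ)) * S →
      VanishesAlong 𝔟 (thetaEval L κM P) ((s : ℂ) • v) (Fintype.card (β ⊕ (γ ⊕ δ)) * T + 1)) :
    ∃ H₀ : AddSubgroup (β ⊕ (γ ⊕ δ) → ℂ), (thetaModel₀ (β := β) L κM).IsIrred (H₀ : Set (β ⊕ (γ ⊕ δ) → ℂ)) ∧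
      (∃ v₀, ∀ h ∈ H₀, thetaEval L κM P (v₀ + h) = 0) ∧
      (T + (finrank ℂ 𝔟 - finrank ℂ ↥(𝔟 ⊓ AnalyticGroupModel.linSpace (↑H₀ : Set (β ⊕ (γ ⊕ δ) → ℂ))))).choose
          (finrank ℂ 𝔟 - finrank ℂ ↥(𝔟 ⊓ AnalyticGroupModel.linSpace (↑H₀ : Set (β ⊕ (γ ⊕ δ) → ℂ)))) *
        ((fun σ => σ +ᵥ (↑H₀ : Set (β ⊕ (γ ⊕ δ) → ℂ))) '' AnalyticGroupModel.multiples v S).ncard *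
        D ^ ((thetaModel₀ (β := β) L κM).coneDim (↑H₀ : Set (β ⊕ (γ ⊕ δ) → ℂ)) - 1) ≤
      (thetaModel₀ (β := β) L κM).mainConst * D ^ Fintype.card (β ⊕ (γ ⊕ δ)) :=
  zero_estimate_theta L κM (hardData L κM) 𝔟 v S T hP hP0 hvan

/-- **`philippon1986_std` for `(L, κ, β, γ, δ)` from the classification of the closed irreducible
subgroups of `Lie M_κ,ℂ` alone** (hypothesis `hCL` of `philippon_shape_of_classification`; the hard
data is now supplied). [cite: Philippon1986, Thm. 2.1] -/
theorem philippon_of_classification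
    (hCL : ∀ H₀ : AddSubgroup (β ⊕ (γ ⊕ δ) → ℂ), (thetaModel₀ (β := β) L κM).IsIrred (H₀ : Set (β ⊕ (γ ⊕ δ) → ℂ)) →
      ∃ K : SubgroupDataC β γ δ κM, (preimageSubgroup L κM K : Set (β ⊕ (γ ⊕ δ) → ℂ)) = H₀ ∧
        AnalyticGroupModel.linSpace (↑H₀ : Set (β ⊕ (γ ⊕ δ) → ℂ)) = K.tangent ∧
        finrank ℂ K.tangent + 1 ≤ (thetaModel₀ (β := β) L κM).coneDim (↑H₀ : Set (β ⊕ (γ ⊕ δ) → ℂ))) :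
    ∃ c : ℝ, 0 < c ∧ ∀ (𝔟 : Submodule ℂ (β ⊕ (γ ⊕ δ) → ℂ)) (v : β ⊕ (γ ⊕ δ) → ℂ)
        (P : MvPolynomial (Option β × ThetaIdx γ δ) ℂ) (D S T : ℕ),
        0 < Module.finrank ℂ 𝔟 → 1 ≤ D → 1 ≤ S → P.IsHomogeneous D → (∃ w, thetaEval L κM P w ≠ 0) →
        (∀ s : ℕ, s ≤ Fintype.card (β ⊕ (γ ⊕ δ)) * S →
          VanishesAlong 𝔟 (thetaEval L κM P) ((s : ℂ) • v) (Fintype.card (β ⊕ (γ ⊕ δ)) * T + 1)) →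
        ∃ K : SubgroupDataC β γ δ κM,
          (∃ w₀, ∀ w ∈ K.tangent, thetaEval L κM P (w₀ + w) = 0) ∧
          (Nat.choose (T + (Module.finrank ℂ 𝔟 - Module.finrank ℂ ↥(𝔟 ⊓ K.tangent)))
              (Module.finrank ℂ 𝔟 - Module.finrank ℂ ↥(𝔟 ⊓ K.tangent)) : ℝ) *
            (orbitCard L κM K v S : ℝ) * (D : ℝ) ^ Module.finrank ℂ K.tangent ≤
            c * (D : ℝ) ^ Fintype.card (β ⊕ (γ ⊕ δ)) :=
  philippon_shape_of_classification L κM (hardData L κM) hCL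

end Std

end GaGmE

end Literature.NumberTheory.Transcendental

end
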